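import Summits.BirchSwinnertonDyer.BirchSwinnertonDyer.Theorems.AlignedTransportAtTwoMainConjectureOfRankZeroBSDAtTwoRoadLambdaAtLeastThree
import HarnessLib

/-!
# Route `AlignedTransportAtTwo`, crux C2 `MainConjectureOfRankZeroBSDAtTwo` (stmt-BirchSwinnertonDyer-22298):
# ON THE `a₂ = +1` HALF OF THE ROAD THE ZERO OF `L₂(W,T)` AT THE ORDER-2 CHARACTER IS SIMPLE — `ord_{T=−2} L₂ ≤ 2·ord₂ #Ẽ(𝔽₂)`,
# so `a₂ = +1 ⇒ ord₋₂ L₂ = 1` and `a₂ = −1 ⇒ ord₋₂ L₂ ∈ {1, 3}` (given the road's `L`-value bit; NO `μ`-hypothesis)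

HONEST FRAMING (cell `bsd-f1-sign2`, WIDTH-5 attached prover seat `bsd-line-att-p5` gen 33 on line `birth` of the lead
`bsd-line-att-p2`; `--supports` stmt-BirchSwinnertonDyer-22298, closes nothing; BSD is NOT proved by any of this; the crux C2, its
verdict «blocked-on `Rank1Residual.GreenbergMuConjectureIrreducible`» and every registered stub are untouched). THEOREMS ONLY (no `def`,
no named fact, no `sorry`); sequel of this seat's `…RoadSecondFixedPoint` (ord₋₂ odd on the road) and `…RoadLambdaAtLeastThree`
(`‖L₂(W,0)‖₂ = ‖#Ẽ(𝔽₂)‖₂²·‖[0]⁺_f‖₂`). The one named-fact binder (`hper`, §3 only) is the road's own PRINT input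
`realPeriodRat_eq_unit_mul_plusPeriod_two`.

THE OBSERVATION. If `L₀ = (T+2)^n·H` is the integral lift of `L₂(W,T)` then `L₀(0) = 2^n·H(0)`, so `‖L₀(0)‖₂ ≤ 2^{−n}`; but
`‖L₀(0)‖₂ = ‖#Ẽ(𝔽₂)‖₂²·‖[0]⁺_f‖₂` EXACTLY. Hence, when the central symbol is a `2`-adic unit (the road's odd-`L/Ω` branch):
* §1 **`‖#Ẽ(𝔽₂)‖₂² ≤ 2^{−ord₋₂ L₂}`**, i.e. `ord_{T=−2} L₂ ≤ 2·ord₂ #Ẽ(𝔽₂)` — with NO hypothesis on `μ`;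
* §2 for good ORDINARY `W` at `2`, `#Ẽ(𝔽₂) = 3 − a₂ ∈ {2, 4}`: **`a₂ = +1 ⇒ ord₋₂ L₂ ≤ 2`, hence `= 1` on the road** (where it is odd):
  the forced zero at `χ₈` is SIMPLE (`orderAtNegTwo_eq_one_of_road_of_frobeniusTrace_eq_one`); **`a₂ = −1 ⇒ ord₋₂ L₂ ∈ {1, 3}`**;
  with `μ(L₀) = 0` in addition, on `a₂ = +1`: `L₀ = (T+2)·H`, `‖H(0)‖₂ = ½` exactly and `λ(H) = λ₂ − 1` is EVEN `≥ 2` — the cofactor's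
  distinguished polynomial has constant term `2·unit`, i.e. is EISENSTEIN: the free zeros form ONE Galois orbit of slope `1/(λ₂ − 1)`
  (reading; cf. -imc g33's «`L♯ = (T+2)·T^{[a=2]}·R·u`, `R` Eisenstein» on the supersingular `a₂ = ±2` branch);
* §3 the same in the road's currency (`hper` + «`L(W,1)/Ω_W = q`, `ord₂ q = 0`»).
Census reading (crux memo CHI8-TWIST-att-p5-g32 §3/§6): 22 of the 23 firing rank-0 road curves have `a₂ = +1` — on all of them the `χ₈`-zero is
simple and `λ₂ − 1 ∈ {2, 4, 6, 10, 14}` is the degree of one Eisenstein factor (g32: `P′(−2) ≠ 0` checked at `N = 2515`).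

References: B. Mazur, J. Tate, J. Teitelbaum, Invent. Math. 84 (1986) §I.14 (14.3) [MazurTateTeitelbaum1986Invent]; R. Greenberg, LNM 1716
(1999), §5 p. 181 [GreenbergLNM1716]; L. Washington, GTM 83, §7.1 [Washington1997].
-/

set_option linter.dupNamespace false
set_option autoImplicit false

noncomputable section

open scoped Classical MatrixGroups ModularForm

namespace Summit.BirchSwinnertonDyer.BirchSwinnertonDyer.Theorems.AlignedTransportAtTwoRoadSecondFixedPoint

open PowerSeries CongruenceSubgroup WeierstrassCurve Literature.NumberTheory.EllipticCurves
  Literature.NumberTheory.EllipticCurves.ModularForms Literature.Barriers.BirchSwinnertonDyer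
  Summit.BirchSwinnertonDyer.Rank1Residual.Supersingular Summit.BirchSwinnertonDyer.Rank1Residual.F1Sign2
  Summit.BirchSwinnertonDyer.Rank1Residual.X1.MuLambda
  Summit.BirchSwinnertonDyer.BirchSwinnertonDyer.Theorems.AlignedTransportAtTwoTwoFixedPoints

variable {W : WeierstrassCurve ℚ} [W.IsElliptic] [W.IsGloballyMinimal] [NeZero (W.conductorNorm ℤ)]
  {f : CuspForm (Gamma0 (W.conductorNorm ℤ)) 2}

/-! ## §1 `‖#Ẽ(𝔽₂)‖² ≤ 2^{−ord₋₂ L₂}` — no `μ`-hypothesis -/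

/-- If `(T+2)^n ∣ L₀` then `‖L₀(0)‖₂ ≤ 2^{−n}` (`L₀(0) = 2^n·H(0)`). [folklore] -/
theorem norm_constantCoeff_le_of_X_add_C_two_pow_dvd {L₀ : PowerSeries ℤ_[2]} {n : ℕ}
    (h : (X + C (2 : ℤ_[2])) ^ n ∣ L₀) : ‖constantCoeff L₀‖ ≤ (2⁻¹ : ℝ) ^ n := by
  obtain ⟨H, rfl⟩ := h
  have h2n : ‖(2 : ℤ_[2])‖ = 2⁻¹ := by
    rw [show (2 : ℤ_[2]) = ((2 : ℕ) : ℤ_[2]) by norm_cast, PadicInt.norm_p]; norm_num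
  rw [map_mul, map_pow, map_add, constantCoeff_X, constantCoeff_C, zero_add, norm_mul, norm_pow, h2n]
  calc (2⁻¹ : ℝ) ^ n * ‖constantCoeff H‖ ≤ (2⁻¹ : ℝ) ^ n * 1 := by gcongr; exact PadicInt.norm_le_one _
    _ = (2⁻¹ : ℝ) ^ n := mul_one _

/-- **`‖#Ẽ(𝔽₂)‖₂² ≤ 2^{−ord_{T=−2} L₂}`** for the integral lift `L₀` of `L₂(W,T)` of a good ordinary `W` whose central symbol `[0]⁺_f` is a
`2`-adic unit: `ord_{T=−2} L₂ ≤ 2·ord₂ #Ẽ(𝔽₂)`. No hypothesis on `μ`. [cite: MazurTateTeitelbaum1986Invent, §I.14 (14.3)] -/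
theorem norm_reductionPointCount_sq_le (hord : IsOrdinaryAt W 2) (hf : IsNewformOf W f)
    {L₀ : PowerSeries ℤ_[2]} (hL₀ : iwasawaToPowerSeries 2 L₀ = padicLFunction f (unitRoot W 2 : ℚ_[2]))
    (hsym : ‖(ratPlusSymbol f 0 : ℚ_[2])‖ = 1) {n : ℕ} (hn : (X + C (2 : ℤ_[2])) ^ n ∣ L₀) :
    ‖(W.reductionPointCount 2 : ℚ_[2])‖ ^ 2 ≤ (2⁻¹ : ℝ) ^ n := by
  have hl : ((constantCoeff L₀ : ℤ_[2]) : ℚ_[2]) = constantCoeff (padicLFunction f (unitRoot W 2 : ℚ_[2])) := by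
    rw [← hL₀, ← coeff_zero_eq_constantCoeff_apply, ← coeff_zero_eq_constantCoeff_apply]
    exact (Wuthrich2014.coeff_iwasawaToPowerSeries 2 L₀ 0).symm
  have h := norm_constantCoeff_le_of_X_add_C_two_pow_dvd hn
  rwa [PadicInt.norm_def, hl, norm_constantCoeff_padicLFunction_eq hord hf, hsym, mul_one] at h

/-! ## §2 `a₂ = +1`: the zero at `χ₈` is SIMPLE; `a₂ = −1`: order `1` or `3` -/

omit [W.IsElliptic] [NeZero (W.conductorNorm ℤ)] in
/-- `#Ẽ(𝔽₂) = 3 − a₂` (the tree's definition `frobeniusTrace W p = p + 1 − #Ẽ(𝔽_p)`). [folklore] -/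
theorem reductionPointCount_two_eq (a : ℤ) (ha : W.frobeniusTrace 2 = a) : (W.reductionPointCount 2 : ℤ) = 3 - a := by
  rw [← ha, frobeniusTrace]; push_cast; ring

/-- **`a₂ = +1 ⇒ ord_{T=−2} L₂ ≤ 2`** (`#Ẽ(𝔽₂) = 2`, `‖·‖² = ¼ ≤ 2^{−n}`), for any good ordinary `W` with `‖[0]⁺_f‖₂ = 1`; no `μ`-hypothesis.
[cite: MazurTateTeitelbaum1986Invent, §I.14 (14.3)] -/
theorem orderAtNegTwo_le_two_of_frobeniusTrace_eq_one (hord : IsOrdinaryAt W 2) (hf : IsNewformOf W f) (ha : W.frobeniusTrace 2 = 1)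
    {L₀ : PowerSeries ℤ_[2]} (hL₀ : iwasawaToPowerSeries 2 L₀ = padicLFunction f (unitRoot W 2 : ℚ_[2]))
    (hsym : ‖(ratPlusSymbol f 0 : ℚ_[2])‖ = 1) {n : ℕ} (hn : (X + C (2 : ℤ_[2])) ^ n ∣ L₀) : n ≤ 2 := by
  have hN : W.reductionPointCount 2 = 2 := by have := reductionPointCount_two_eq 1 ha; omega
  have h := norm_reductionPointCount_sq_le hord hf hL₀ hsym hn
  rw [hN, Padic.norm_p] at h
  -- `h : (2⁻¹)^2 ≤ (2⁻¹)^n`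
  have h' : ((2 : ℝ)⁻¹) ^ 2 ≤ (2⁻¹ : ℝ) ^ n := by exact_mod_cast h
  by_contra hlt
  have h3 : (2⁻¹ : ℝ) ^ n ≤ (2⁻¹ : ℝ) ^ 3 := pow_le_pow_of_le_one (by norm_num) (by norm_num) (by omega)
  have : ((2 : ℝ)⁻¹) ^ 2 ≤ (2⁻¹ : ℝ) ^ 3 := h'.trans h3
  norm_num at this

/-- **`a₂ = −1 ⇒ ord_{T=−2} L₂ ≤ 4`** (`#Ẽ(𝔽₂) = 4`). [cite: MazurTateTeitelbaum1986Invent, §I.14 (14.3)] -/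
theorem orderAtNegTwo_le_four_of_frobeniusTrace_eq_neg_one (hord : IsOrdinaryAt W 2) (hf : IsNewformOf W f)
    (ha : W.frobeniusTrace 2 = -1)
    {L₀ : PowerSeries ℤ_[2]} (hL₀ : iwasawaToPowerSeries 2 L₀ = padicLFunction f (unitRoot W 2 : ℚ_[2]))
    (hsym : ‖(ratPlusSymbol f 0 : ℚ_[2])‖ = 1) {n : ℕ} (hn : (X + C (2 : ℤ_[2])) ^ n ∣ L₀) : n ≤ 4 := by
  have hN : W.reductionPointCount 2 = 4 := by have := reductionPointCount_two_eq (-1) ha; omega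
  have h := norm_reductionPointCount_sq_le hord hf hL₀ hsym hn
  rw [hN, show ((4 : ℕ) : ℚ_[2]) = ((2 : ℕ) : ℚ_[2]) ^ 2 by norm_num, norm_pow, Padic.norm_p] at h
  have h' : (((2 : ℝ)⁻¹) ^ 2) ^ 2 ≤ (2⁻¹ : ℝ) ^ n := by exact_mod_cast h
  by_contra hlt
  have h5 : (2⁻¹ : ℝ) ^ n ≤ (2⁻¹ : ℝ) ^ 5 := pow_le_pow_of_le_one (by norm_num) (by norm_num) (by omega)
  have : (((2 : ℝ)⁻¹) ^ 2) ^ 2 ≤ (2⁻¹ : ℝ) ^ 5 := h'.trans h5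
  norm_num at this

/-- **ON THE `a₂ = +1` HALF OF THE ROAD THE ZERO AT THE ORDER-2 CHARACTER IS SIMPLE: `ord_{T=−2} L₂(W,T) = 1`.** For `W` globally minimal,
good ordinary at `2` with `a₂ = +1`, `∏ c_v` odd, `Δ_min ≡ 3, 5 (mod 8)`, `r_an(W) = 0`, `f` its newform at level `N_W`, `‖[0]⁺_f‖₂ = 1`, and `L₀` the
integral lift of `L₂(W,T)`: the order of `L₀` at `T = −2` is odd (companion file) and `≤ 2`, hence `1`. No hypothesis on `μ`.
[cite: GreenbergLNM1716, §5 p. 181] -/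
theorem orderAtNegTwo_eq_one_of_road_of_frobeniusTrace_eq_one (hord : IsOrdinaryAt W 2) (hf : IsNewformOf W f)
    (ha : W.frobeniusTrace 2 = 1) (hodd : Odd W.tamagawaProduct)
    (hΔ : minimalDiscriminantInt W % 8 = 3 ∨ minimalDiscriminantInt W % 8 = 5) (hr : W.analyticRank = 0)
    {L₀ : PowerSeries ℤ_[2]} (hL₀ : iwasawaToPowerSeries 2 L₀ = padicLFunction f (unitRoot W 2 : ℚ_[2]))
    (hsym : ‖(ratPlusSymbol f 0 : ℚ_[2])‖ = 1) {n : ℕ} (hn : HasOrderAtNegTwo L₀ n) : n = 1 := by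
  have hg : iwasawaToPowerSeries 2 L₀ = C (1 : ℚ_[2]) * padicLFunction f (unitRoot W 2 : ℚ_[2]) := by
    rw [map_one, one_mul]; exact hL₀
  have hodd' : Odd n := odd_orderAtNegTwo_of_road hord hf hodd hΔ hr hg hn
  have hle : n ≤ 2 := orderAtNegTwo_le_two_of_frobeniusTrace_eq_one hord hf ha hL₀ hsym hn.1
  obtain ⟨k, hk⟩ := hodd'
  omega

/-- **On the `a₂ = −1` half of the road `ord_{T=−2} L₂(W,T) ∈ {1, 3}`.** [cite: GreenbergLNM1716, §5 p. 181] -/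
theorem orderAtNegTwo_eq_one_or_three_of_road_of_frobeniusTrace_eq_neg_one (hord : IsOrdinaryAt W 2) (hf : IsNewformOf W f)
    (ha : W.frobeniusTrace 2 = -1) (hodd : Odd W.tamagawaProduct)
    (hΔ : minimalDiscriminantInt W % 8 = 3 ∨ minimalDiscriminantInt W % 8 = 5) (hr : W.analyticRank = 0)
    {L₀ : PowerSeries ℤ_[2]} (hL₀ : iwasawaToPowerSeries 2 L₀ = padicLFunction f (unitRoot W 2 : ℚ_[2]))
    (hsym : ‖(ratPlusSymbol f 0 : ℚ_[2])‖ = 1) {n : ℕ} (hn : HasOrderAtNegTwo L₀ n) : n = 1 ∨ n = 3 := by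
  have hg : iwasawaToPowerSeries 2 L₀ = C (1 : ℚ_[2]) * padicLFunction f (unitRoot W 2 : ℚ_[2]) := by
    rw [map_one, one_mul]; exact hL₀
  have hodd' : Odd n := odd_orderAtNegTwo_of_road hord hf hodd hΔ hr hg hn
  have hle : n ≤ 4 := orderAtNegTwo_le_four_of_frobeniusTrace_eq_neg_one hord hf ha hL₀ hsym hn.1
  obtain ⟨k, hk⟩ := hodd'
  omega

/-- **The cofactor on `a₂ = +1` (with `μ₂ = 0`): `L₀ = (T+2)·H`, `‖H(0)‖₂ = ½` exactly, `λ(H) = λ₂ − 1` EVEN and `≥ 2`** — the distinguished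
polynomial of `H` has constant term `2·unit` and all lower coefficients even, i.e. it is an Eisenstein polynomial of even degree `λ₂ − 1`
(reading: the free zeros of `L₂(W,T)` form one Galois orbit of slope `1/(λ₂−1)`). [cite: Washington1997, §7.1] -/
theorem exists_cofactor_of_road_of_frobeniusTrace_eq_one (hord : IsOrdinaryAt W 2) (hf : IsNewformOf W f)
    (ha : W.frobeniusTrace 2 = 1) (hodd : Odd W.tamagawaProduct)
    (hΔ : minimalDiscriminantInt W % 8 = 3 ∨ minimalDiscriminantInt W % 8 = 5) (hr : W.analyticRank = 0)
    {L₀ : PowerSeries ℤ_[2]} (hL₀ : iwasawaToPowerSeries 2 L₀ = padicLFunction f (unitRoot W 2 : ℚ_[2]))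
    (hμ : mu L₀ = 0) (hsym : ‖(ratPlusSymbol f 0 : ℚ_[2])‖ = 1) :
    ∃ H : PowerSeries ℤ_[2], L₀ = (X + C (2 : ℤ_[2])) * H ∧ ‖constantCoeff H‖ = 2⁻¹ ∧ Even (lam H) ∧ 2 ≤ lam H := by
  have hg : iwasawaToPowerSeries 2 L₀ = C (1 : ℚ_[2]) * padicLFunction f (unitRoot W 2 : ℚ_[2]) := by
    rw [map_one, one_mul]; exact hL₀
  have h0 : constantCoeff L₀ ≠ 0 := constantCoeff_ne_zero_of_analyticRank_eq_zero hord hf hr one_ne_zero hg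
  have hL : L₀ ≠ 0 := fun h => h0 (by rw [h, map_zero])
  obtain ⟨H, hH⟩ := X_add_C_two_dvd_of_road hord hf hodd hΔ hr hg
  have hX0 : (X + C (2 : ℤ_[2]) : PowerSeries ℤ_[2]) ≠ 0 := prime_X_add_C_two.ne_zero
  have hH0 : H ≠ 0 := by rintro rfl; exact hL (by rw [hH, mul_zero])
  -- `‖L₀(0)‖ = ¼` and `L₀(0) = 2·H(0)`
  have hl : ((constantCoeff L₀ : ℤ_[2]) : ℚ_[2]) = constantCoeff (padicLFunction f (unitRoot W 2 : ℚ_[2])) := by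
    rw [← hL₀, ← coeff_zero_eq_constantCoeff_apply, ← coeff_zero_eq_constantCoeff_apply]
    exact (Wuthrich2014.coeff_iwasawaToPowerSeries 2 L₀ 0).symm
  have hN : W.reductionPointCount 2 = 2 := by have := reductionPointCount_two_eq 1 ha; omega
  have hnormL : ‖constantCoeff L₀‖ = 4⁻¹ := by
    rw [PadicInt.norm_def, hl, norm_constantCoeff_padicLFunction_eq hord hf, hsym, mul_one, hN, Padic.norm_p]; norm_num
  have h2n : ‖(2 : ℤ_[2])‖ = 2⁻¹ := by
    rw [show (2 : ℤ_[2]) = ((2 : ℕ) : ℤ_[2]) by norm_cast, PadicInt.norm_p]; norm_num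
  have hc : constantCoeff L₀ = 2 * constantCoeff H := by
    rw [hH, map_mul, map_add, constantCoeff_X, constantCoeff_C, zero_add]
  have hHn : ‖constantCoeff H‖ = 2⁻¹ := by
    have h := hnormL
    rw [hc, norm_mul, h2n] at h
    linarith
  -- `λ(H) = λ(L₀) − 1` even ≥ 2
  have hlam : lam L₀ = 1 + lam H := by rw [hH, lam_mul hX0 hH0, lam_X_add_C_two]
  have hodd' : Odd (lam L₀) := odd_lam_of_road hord hf hodd hΔ hg hL
  have h3 : 3 ≤ lam L₀ := three_le_lam_integralLift_of_road hord hf hodd hΔ hr hL₀ hμ hsym.le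
  refine ⟨H, hH, hHn, ?_, by omega⟩
  obtain ⟨k, hk⟩ := hodd'
  exact ⟨k, by omega⟩

/-! ## §3 In the road's currency -/

/-- **Simple zero at `χ₈` on the `a₂ = +1` half of the road, in the road's currency** (`hper` + «`L(W,1)/Ω_W = q`, `ord₂ q = 0`» supply
`‖[0]⁺_f‖₂ = 1`; `E[2]` irreducible). [cite: AbbesUllmo1996, Thm. A] -/
theorem orderAtNegTwo_eq_one_of_road_of_frobeniusTrace_eq_one_of_lValue (hper : realPeriodRat_eq_unit_mul_plusPeriod_two)
    (hord : IsOrdinaryAt W 2) (hirr : W.HasIrreducibleModPGaloisRep 2) (hf : IsNewformOf W f) (ha : W.frobeniusTrace 2 = 1)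
    (hodd : Odd W.tamagawaProduct) (hΔ : minimalDiscriminantInt W % 8 = 3 ∨ minimalDiscriminantInt W % 8 = 5) (hr : W.analyticRank = 0)
    (hL : ∃ q : ℚ, q ≠ 0 ∧ W.entireLFunction 1 / (W.realPeriodRat : ℂ) = (q : ℂ) ∧ padicValRat 2 q = 0)
    {L₀ : PowerSeries ℤ_[2]} (hL₀ : iwasawaToPowerSeries 2 L₀ = padicLFunction f (unitRoot W 2 : ℚ_[2]))
    {n : ℕ} (hn : HasOrderAtNegTwo L₀ n) : n = 1 :=
  orderAtNegTwo_eq_one_of_road_of_frobeniusTrace_eq_one hord hf ha hodd hΔ hr hL₀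
    (norm_ratPlusSymbol_zero_eq_one_of_lValue hper hord.1 hirr hf hL) hn

end Summit.BirchSwinnertonDyer.BirchSwinnertonDyer.Theorems.AlignedTransportAtTwoRoadSecondFixedPoint

end
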